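import Summits.QuantumFields.YangMills.Theorems.UnitScaleTiltProp8FibreTangentAvg
import HarnessLib

/-!
# Route `UnitScaleTilt`, crux K1 «MinimiserStabilityRegPr» (stmt-QuantumFields-19200), stub `stub_prop8` (V2) — sub-lemma V2-EL, part 5b: **THE ONE-STEP
# EULER–LAGRANGE EQUATION IN MULTIPLIER FORM, PROVED** (`exists_tangent_lin_eq_zero`): the one-step fibre `{U : Ū = Ū₀}` of Bałaban's (0.4) averaging carries,
# through every small `U₀` (`PlaqSmall t₀ U₀`, `stokesConst·t₀ ≤ |I|⁻¹/1000`), DIFFERENTIABLE curves with arbitrary velocity at any non-central bond and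
# compensating velocities at the central crossing bonds only; hence for a minimiser of the `SU(2)` Wilson action over any set containing the germ of that fibre,
# `∃ ξ, ξ(b₀) = D₀U₀(b₀)^*, ξ = 0 off {b₀} ∪ {central bonds}, Lin_{U₀}(ξ) = 0` — the current at a non-central bond is balanced by the central-bond currents.
Cell `ym3-torus` ∕ fleet seat `ym-ust-19200-p2` g3.  [Balaban1985Variational] p. 300 / (127) p. 297 take the admissible variations from the chart (47); here, for ONE
(0.4) step, they come from the exact corrector (`BlockAvgCorrector.exists_avgFun_eq_of_near`, p448916) and the implicit differentiation of parts 3–4, and feed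
part 3's `lin_eq_zero_of_isMinOn_of_hasDerivAt`; with part 2's `isCritR2_oneStepSlice` this is the criticality equation of the carrier's R2-critical
configurations.  PROOF: `Γ₀(t) = U₀[b₀ ↦ g(t)]`; defect `η(t) = O(t)` (part 5a); on a neighbourhood of `0` the corrector gives `γ(t)` with `γ̄(t) = Ū₀`,
`γ = Γ₀` off the central bonds, `‖γ − Γ₀‖ ≤ 2η|I|`; the central coordinates `W_c(t) = pre·γ(t)(βc)·post` solve `eml(1 | h_i(t)W^*)W = Ū₀(c)` and are Lipschitz,
hence differentiable (parts 3–4); so every bond of `γ` is differentiable at `0`, `γ(0) = U₀`, `γ(t) ∈ S` eventually.  Sorry-free, no definition. [folklore] ∕ cited.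
References: T. Bałaban, CMP 102 (1985) 277–309 [Balaban1985Variational] ((127) p.297, p.300); CMP 109 (1987) 249–301 [Balaban1987RG1] ((0.4) p.253).
-/

noncomputable section

open scoped BigOperators Matrix.Norms.L2Operator Matrix
open Filter Topology Asymptotics NormedSpace Function

namespace Summit.QuantumFields.YangMills.Theorems.Prop8Criticality

open Literature.MathematicalPhysics.QuantumFieldTheory.Balaban1983to89
open T4Continuum AveragingRT BlockAveraging BlockAveragingHaarAC BlockAveragingEMLHaarAC ExpMeanLog
open B7TransferAnalyticMean BlockAveragingEMLAnalyticMean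
open Summit.QuantumFields.YangMills.Theorems.BlockAvgCorrector (stokesConst stokesConst_nonneg emlWeight_pos emlWeight_le_one
  norm_openHol_mul_star_sub_one_le plaqSmall_of_forall_norm_sub_le exists_avgFun_eq_of_near)

variable {P : Params} {j : ℕ}

/-! ## The one-step Euler–Lagrange equation in multiplier form -/

section Tangent

/-- **THE ONE-STEP EULER–LAGRANGE EQUATION IN MULTIPLIER FORM** (the tangent curves of the one-step (0.4)-fibre and the vanishing of the first variation
along them).  Let `U₀` be `t₀`-small with `stokesConst·t₀ ≤ |I|⁻¹/1000` (loop variables of (0.4) deep inside the guard), and let `U₀` minimise the `SU(2)`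
Wilson action over a set `S` containing the germ at `U₀` of its one-step fibre `{U : Ū = Ū₀}`.  Then for every NON-CENTRAL bond `b₀` and every
differentiable `SU(2)`-valued curve `g` through `U₀(b₀)` with velocity `D₀` there is a bond field `ξ` — the velocity of a curve INSIDE the fibre obtained
by re-solving the central bonds (exact corrector p448916; differentiable by parts 3–4) — with `ξ(b₀) = D₀U₀(b₀)^*`, `ξ = 0` at every other non-central
bond, and `Lin_{U₀}(ξ) = 0`: the first variation at `b₀` is balanced by first variations at the central bonds alone (the multipliers).
[cite: Balaban1985Variational, (127) p.297; Balaban1987RG1, (0.4) p.253] -/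
theorem exists_tangent_lin_eq_zero [DecidableEq (PBond P j)] (hj : j + 1 ≤ P.m + P.K) {t₀ : ℝ} (ht₀ : 0 < t₀)
    (hsmall : stokesConst P * t₀ ≤ emlWeight P / 1000)
    (U₀ : GaugeField P j (Matrix.specialUnitaryGroup (Fin 2) ℂ)) (hU₀ : PlaqSmall t₀ U₀)
    {S : Set (GaugeField P j (Matrix.specialUnitaryGroup (Fin 2) ℂ))}
    (hmin : IsMinOn (fun W : GaugeField P j (Matrix.specialUnitaryGroup (Fin 2) ℂ) => wilsonAction4 W) S U₀)
    (hS : ∃ δ : ℝ, 0 < δ ∧ ∀ U : GaugeField P j (Matrix.specialUnitaryGroup (Fin 2) ℂ),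
      avgFun (expMeanLogSU (n := Fin 2)) U = avgFun (expMeanLogSU (n := Fin 2)) U₀ →
        (∀ b, ‖(U b : Matrix (Fin 2) (Fin 2) ℂ) - (U₀ b : Matrix (Fin 2) (Fin 2) ℂ)‖ < δ) → U ∈ S)
    (b₀ : PBond P j) (hb₀ : ∀ c : PBond P (j + 1), centralBond c ≠ b₀)
    (g : ℝ → Matrix.specialUnitaryGroup (Fin 2) ℂ) (hg0 : g 0 = U₀ b₀) {D₀ : Matrix (Fin 2) (Fin 2) ℂ}
    (hg : HasDerivAt (fun t : ℝ => (g t : Matrix (Fin 2) (Fin 2) ℂ)) D₀ 0) :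
    ∃ ξ : PBond P j → Matrix (Fin 2) (Fin 2) ℂ,
      ξ b₀ = D₀ * star (U₀ b₀ : Matrix (Fin 2) (Fin 2) ℂ) ∧
      (∀ b : PBond P j, b ≠ b₀ → (∀ c : PBond P (j + 1), centralBond c ≠ b) → ξ b = 0) ∧
      ∑ p : Plaq P j, (1 / 2) * ((((((GaugeField.plaqHol U₀ p : Matrix.specialUnitaryGroup (Fin 2) ℂ) : Matrix (Fin 2) (Fin 2) ℂ)) - 1)ᴴ
          * ((ξ ⟨p.src, p.μ⟩
              + (U₀ ⟨p.src, p.μ⟩ : Matrix (Fin 2) (Fin 2) ℂ) * ξ ⟨p.src.shift p.μ, p.ν⟩ * star (U₀ ⟨p.src, p.μ⟩ : Matrix (Fin 2) (Fin 2) ℂ)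
              - ((U₀ ⟨p.src, p.μ⟩ * U₀ ⟨p.src.shift p.μ, p.ν⟩ * (U₀ ⟨p.src.shift p.ν, p.μ⟩)⁻¹ : Matrix.specialUnitaryGroup (Fin 2) ℂ) : Matrix (Fin 2) (Fin 2) ℂ)
                  * ξ ⟨p.src.shift p.ν, p.μ⟩
                  * star ((U₀ ⟨p.src, p.μ⟩ * U₀ ⟨p.src.shift p.μ, p.ν⟩ * (U₀ ⟨p.src.shift p.ν, p.μ⟩)⁻¹ : Matrix.specialUnitaryGroup (Fin 2) ℂ) : Matrix (Fin 2) (Fin 2) ℂ)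
              - ((GaugeField.plaqHol U₀ p : Matrix.specialUnitaryGroup (Fin 2) ℂ) : Matrix (Fin 2) (Fin 2) ℂ) * ξ ⟨p.src, p.ν⟩
                  * star ((GaugeField.plaqHol U₀ p : Matrix.specialUnitaryGroup (Fin 2) ℂ) : Matrix (Fin 2) (Fin 2) ℂ))
            * ((GaugeField.plaqHol U₀ p : Matrix.specialUnitaryGroup (Fin 2) ℂ) : Matrix (Fin 2) (Fin 2) ℂ))).trace).re = 0 := by
  set ℰ : LoopAverage (Matrix.specialUnitaryGroup (Fin 2) ℂ) := expMeanLogSU (n := Fin 2) with hℰ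
  set κ : ℝ := emlWeight P with hκdef
  have hκ : 0 < κ := emlWeight_pos P
  have hκ1 : κ ≤ 1 := emlWeight_le_one P
  have hst : 0 ≤ stokesConst P := stokesConst_nonneg P
  have hδ : ℰ.δ = 1 / 3 := expMeanLogSU_two_δ
  set Γ₀ : ℝ → GaugeField P j (Matrix.specialUnitaryGroup (Fin 2) ℂ) := fun t => update U₀ b₀ (g t) with hΓ₀
  have hΓ₀0 : Γ₀ 0 = U₀ := by simp only [hΓ₀, hg0, update_eq_self]
  have hΓ₀ne : ∀ t b, b ≠ b₀ → Γ₀ t b = U₀ b := fun t b hb => by simp only [hΓ₀, update_of_ne hb]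
  have hΓ₀b₀ : ∀ t, Γ₀ t b₀ = g t := fun t => by simp only [hΓ₀, update_self]
  have hΓ₀diff : ∀ b : PBond P j, DifferentiableAt ℝ (fun t : ℝ => (Γ₀ t b : Matrix (Fin 2) (Fin 2) ℂ)) 0 := by
    intro b
    by_cases hb : b = b₀
    · subst hb; simp only [hΓ₀b₀]; exact hg.differentiableAt
    · simp only [hΓ₀ne _ b hb]; exact differentiableAt_const _
  set ε : ℝ → ℝ := fun t => ‖(g t : Matrix (Fin 2) (Fin 2) ℂ) - (g 0 : Matrix (Fin 2) (Fin 2) ℂ)‖ with hε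
  have hε0 : ∀ t, 0 ≤ ε t := fun t => norm_nonneg _
  have hΓ₀dist : ∀ t b, ‖(Γ₀ t b : Matrix (Fin 2) (Fin 2) ℂ) - (U₀ b : Matrix (Fin 2) (Fin 2) ℂ)‖ ≤ ε t := by
    intro t b
    by_cases hb : b = b₀
    · subst hb; rw [hΓ₀b₀, ← hg0]
    · rw [hΓ₀ne t b hb, sub_self, norm_zero]; exact hε0 t
  have hΓ₀plaq : ∀ t, PlaqSmall (t₀ + 4 * ε t) (Γ₀ t) := fun t => plaqSmall_of_forall_norm_sub_le hU₀ (hΓ₀dist t)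
  have hε00 : ε 0 = 0 := by simp only [hε, sub_self, norm_zero]
  set V : GaugeField P (j + 1) (Matrix.specialUnitaryGroup (Fin 2) ℂ) := avgFun ℰ U₀ with hV
  set η : ℝ → ℝ := fun t => ∑ c : PBond P (j + 1),
    ‖((V c : Matrix.specialUnitaryGroup (Fin 2) ℂ) : Matrix (Fin 2) (Fin 2) ℂ) - ((avgFun ℰ (Γ₀ t) c : Matrix.specialUnitaryGroup (Fin 2) ℂ) : Matrix (Fin 2) (Fin 2) ℂ)‖ with hη
  have hη0 : ∀ t, 0 ≤ η t := fun t => Finset.sum_nonneg fun c _ => norm_nonneg _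
  have hηc : ∀ t c, ‖((V c : Matrix.specialUnitaryGroup (Fin 2) ℂ) : Matrix (Fin 2) (Fin 2) ℂ)
      - ((avgFun ℰ (Γ₀ t) c : Matrix.specialUnitaryGroup (Fin 2) ℂ) : Matrix (Fin 2) (Fin 2) ℂ)‖ ≤ η t := fun t c =>
    Finset.single_le_sum (f := fun c => ‖((V c : Matrix.specialUnitaryGroup (Fin 2) ℂ) : Matrix (Fin 2) (Fin 2) ℂ)
      - ((avgFun ℰ (Γ₀ t) c : Matrix.specialUnitaryGroup (Fin 2) ℂ) : Matrix (Fin 2) (Fin 2) ℂ)‖) (fun c _ => norm_nonneg _) (Finset.mem_univ c)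
  have hη00 : η 0 = 0 := by
    simp only [hη, hΓ₀0, hV, sub_self, norm_zero, Finset.sum_const_zero]
  have hεcont : Tendsto ε (𝓝 0) (𝓝 0) := by
    have h1 : Tendsto (fun t : ℝ => (g t : Matrix (Fin 2) (Fin 2) ℂ) - (g 0 : Matrix (Fin 2) (Fin 2) ℂ)) (𝓝 0)
        (𝓝 ((g 0 : Matrix (Fin 2) (Fin 2) ℂ) - (g 0 : Matrix (Fin 2) (Fin 2) ℂ))) := hg.continuousAt.tendsto.sub tendsto_const_nhds
    rw [sub_self] at h1
    have h2 := h1.norm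
    rw [norm_zero] at h2
    exact h2
  clear_value ε Γ₀
  have hεev : ∀ᶠ t in 𝓝 (0 : ℝ), ε t ≤ t₀ / 4 := by
    have := (Metric.tendsto_nhds.mp hεcont) (t₀ / 4) (by positivity)
    filter_upwards [this] with t ht
    rw [Real.dist_eq, sub_zero, abs_of_nonneg (hε0 t)] at ht
    exact ht.le
  have hplaq2 : ∀ t, ε t ≤ t₀ / 4 → PlaqSmall (2 * t₀) (Γ₀ t) := fun t ht p =>
    (hΓ₀plaq t p).trans_le (by linarith)
  have h2t₀ : stokesConst P * (2 * t₀) ≤ κ / 500 := by nlinarith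
  have hsmallev : ∀ᶠ t in 𝓝 (0 : ℝ), ∀ c, Small ℰ (Γ₀ t) c := by
    filter_upwards [hεev] with t ht c i
    have h1 := LatticeWordStokes.dist1_loopHol_le (by positivity : (0 : ℝ) ≤ 2 * t₀) (hplaq2 t ht) c i
    rw [hδ]
    refine h1.trans_lt ?_
    show stokesConst P * (2 * t₀) < 1 / 3
    linarith
  have hloop0 : ∀ c i, ‖((loopHol (Γ₀ 0) c i : Matrix.specialUnitaryGroup (Fin 2) ℂ) : Matrix (Fin 2) (Fin 2) ℂ) - 1‖ < 1 := by
    intro c i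
    have h1 := LatticeWordStokes.dist1_loopHol_le ht₀.le (hΓ₀0.symm ▸ hU₀) c i
    rw [SU2Mean.dist1_eq_norm] at h1
    refine h1.trans_lt ?_
    show stokesConst P * t₀ < 1
    nlinarith
  have havgdiff : ∀ c, DifferentiableAt ℝ (fun t : ℝ => ((avgFun ℰ (Γ₀ t) c : Matrix.specialUnitaryGroup (Fin 2) ℂ) : Matrix (Fin 2) (Fin 2) ℂ)) 0 :=
    fun c => differentiableAt_coe_avgFun hΓ₀diff c (hsmallev.mono fun t ht => ht c) (hloop0 c)
  obtain ⟨Cη, hCη0, hηbound⟩ : ∃ C : ℝ, 0 ≤ C ∧ ∀ᶠ t in 𝓝 (0 : ℝ), η t ≤ C * |t| := by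
    have hc := fun c => eventually_norm_sub_le_mul_of_differentiableAt (havgdiff c)
    choose Cc hCc0 hCc using hc
    refine ⟨∑ c, Cc c, Finset.sum_nonneg fun c _ => hCc0 c, ?_⟩
    filter_upwards [Filter.eventually_all.mpr hCc] with t ht
    rw [hη, Finset.sum_mul]
    refine Finset.sum_le_sum fun c _ => ?_
    have h1 := ht c
    rw [hΓ₀0] at h1
    rw [hV, ← norm_neg, neg_sub]
    exact h1
  have hηcont : Tendsto η (𝓝 0) (𝓝 0) := by
    refine squeeze_zero' (Filter.Eventually.of_forall hη0) hηbound ?_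
    have : Tendsto (fun t : ℝ => Cη * |t|) (𝓝 0) (𝓝 (Cη * |(0 : ℝ)|)) := (continuous_const.mul continuous_abs).tendsto 0
    simpa using this
  clear_value η V
  set good : ℝ → Prop := fun t => ε t ≤ t₀ / 4 ∧ stokesConst P * (2 * t₀) + 2 * η t / κ ≤ κ / 16 ∧
    stokesConst P * (2 * t₀ + 4 * (2 * η t / κ)) < 1 / 3 with hgood
  have hgood0 : good 0 := by
    refine ⟨by rw [hε00]; positivity, ?_, ?_⟩
    · rw [hη00]; simp only [mul_zero, zero_div, add_zero]; linarith
    · rw [hη00]; simp only [mul_zero, zero_div, add_zero]; linarith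
  have hgoodev : ∀ᶠ t in 𝓝 (0 : ℝ), good t := by
    have h1 : ∀ᶠ t in 𝓝 (0 : ℝ), η t ≤ κ * κ / 64 := by
      have := (Metric.tendsto_nhds.mp hηcont) (κ * κ / 64) (by positivity)
      filter_upwards [this] with t ht
      rw [Real.dist_eq, sub_zero, abs_of_nonneg (hη0 t)] at ht
      exact ht.le
    have h2 : ∀ᶠ t in 𝓝 (0 : ℝ), η t ≤ κ / (64 * (stokesConst P + 1)) := by
      have := (Metric.tendsto_nhds.mp hηcont) (κ / (64 * (stokesConst P + 1))) (by positivity)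
      filter_upwards [this] with t ht
      rw [Real.dist_eq, sub_zero, abs_of_nonneg (hη0 t)] at ht
      exact ht.le
    filter_upwards [hεev, h1, h2] with t ht h1t h2t
    refine ⟨ht, ?_, ?_⟩
    · have : 2 * η t / κ ≤ κ / 32 := by
        rw [div_le_iff₀ hκ]; nlinarith
      linarith
    · have h2t' : η t * (64 * (stokesConst P + 1)) ≤ κ := (le_div_iff₀ (by positivity)).mp h2t
      have e1 : stokesConst P * (4 * (2 * η t / κ)) ≤ 1 / 8 := by
        rw [show stokesConst P * (4 * (2 * η t / κ)) = (8 * stokesConst P * η t) / κ by ring, div_le_iff₀ hκ]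
        nlinarith [hη0 t]
      have e2 : stokesConst P * (2 * t₀ + 4 * (2 * η t / κ)) = stokesConst P * (2 * t₀) + stokesConst P * (4 * (2 * η t / κ)) := by ring
      rw [e2]
      linarith
  have hcorr : ∀ t, good t → ∃ U' : GaugeField P j (Matrix.specialUnitaryGroup (Fin 2) ℂ), avgFun ℰ U' = V ∧
      (∀ b, (∀ c, centralBond c ≠ b) → U' b = Γ₀ t b) ∧
      ∀ b, ‖((U' b : Matrix.specialUnitaryGroup (Fin 2) ℂ) : Matrix (Fin 2) (Fin 2) ℂ) - (Γ₀ t b : Matrix (Fin 2) (Fin 2) ℂ)‖ ≤ 2 * η t / κ := by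
    intro t ht
    have h2t : (0 : ℝ) ≤ 2 * t₀ := by positivity
    have hguard : stokesConst P * (2 * t₀) + 2 * η t / emlWeight P < (expMeanLogSU (n := Fin 2)).δ := by
      rw [expMeanLogSU_two_δ]; have := ht.2.1; linarith
    exact exists_avgFun_eq_of_near (n := Fin 2) hj h2t (hη0 t) ht.2.1 hguard (Γ₀ t) (hplaq2 t ht.1) V (hηc t)
  have hγex : ∀ t, ∃ U' : GaugeField P j (Matrix.specialUnitaryGroup (Fin 2) ℂ), good t → (avgFun ℰ U' = V ∧
      (∀ b, (∀ c, centralBond c ≠ b) → U' b = Γ₀ t b) ∧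
      ∀ b, ‖((U' b : Matrix.specialUnitaryGroup (Fin 2) ℂ) : Matrix (Fin 2) (Fin 2) ℂ) - (Γ₀ t b : Matrix (Fin 2) (Fin 2) ℂ)‖ ≤ 2 * η t / κ) := by
    intro t
    by_cases ht : good t
    · obtain ⟨U', hU'⟩ := hcorr t ht
      exact ⟨U', fun _ => hU'⟩
    · exact ⟨U₀, fun h => absurd h ht⟩
  choose γ hγspec using hγex
  have hγ0 : γ 0 = U₀ := by
    funext b
    have h1 := (hγspec 0 hgood0).2.2 b
    rw [hη00, mul_zero, zero_div, hΓ₀0] at h1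
    exact Subtype.ext (sub_eq_zero.mp (norm_le_zero_iff.mp h1))
  set W : PBond P (j + 1) → ℝ → Matrix (Fin 2) (Fin 2) ℂ := fun c t =>
    ((pre (Γ₀ t) c : Matrix.specialUnitaryGroup (Fin 2) ℂ) : Matrix (Fin 2) (Fin 2) ℂ) * (γ t (centralBond c) : Matrix (Fin 2) (Fin 2) ℂ)
      * ((post (Γ₀ t) c : Matrix.specialUnitaryGroup (Fin 2) ℂ) : Matrix (Fin 2) (Fin 2) ℂ) with hWdef
  set G : PBond P (j + 1) → Matrix (Fin 2) (Fin 2) ℂ × ℝ → Matrix (Fin 2) (Fin 2) ℂ := fun c p =>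
    eml (fun i => if IsCentral c i then (1 : Matrix (Fin 2) (Fin 2) ℂ) else
      ((openHol (Γ₀ p.2) c i : Matrix.specialUnitaryGroup (Fin 2) ℂ) : Matrix (Fin 2) (Fin 2) ℂ) * star p.1) * p.1 with hGdef
  clear_value W G
  have hGV : ∀ c t, good t → G c (W c t, t) = ((V c : Matrix.specialUnitaryGroup (Fin 2) ℂ) : Matrix (Fin 2) (Fin 2) ℂ) := by
    intro c t ht
    obtain ⟨hV', hoff, hdist⟩ := hγspec t ht
    -- the updated configuration and its smallness at `c`
    have hupd : ∀ b, ‖((update (Γ₀ t) (centralBond c) (γ t (centralBond c)) b : Matrix.specialUnitaryGroup (Fin 2) ℂ) : Matrix (Fin 2) (Fin 2) ℂ)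
        - (Γ₀ t b : Matrix (Fin 2) (Fin 2) ℂ)‖ ≤ 2 * η t / κ := by
      intro b
      by_cases hb : b = centralBond c
      · subst hb; rw [update_self]; exact hdist _
      · rw [update_of_ne hb, sub_self, norm_zero]; exact div_nonneg (by linarith [hη0 t]) hκ.le
    have hplaqu : PlaqSmall (2 * t₀ + 4 * (2 * η t / κ)) (update (Γ₀ t) (centralBond c) (γ t (centralBond c))) :=
      plaqSmall_of_forall_norm_sub_le (hplaq2 t ht.1) hupd
    have hsmu : Small ℰ (update (Γ₀ t) (centralBond c) (γ t (centralBond c))) c := by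
      intro i
      have h2pos : (0 : ℝ) ≤ 2 * t₀ + 4 * (2 * η t / κ) := by
        have := hη0 t
        have : 0 ≤ 2 * η t / κ := div_nonneg (by linarith) hκ.le
        linarith
      have h1 := LatticeWordStokes.dist1_loopHol_le h2pos hplaqu c i
      rw [hδ]
      exact h1.trans_lt ht.2.2
    rw [← hV', avgFun_eq_avgFun_update_of_agree hj ℰ (Γ₀ t) (γ t) c hoff, hGdef, hWdef,
      coe_avgFun_update_centralBond hj (Γ₀ t) c (γ t (centralBond c)) hsmu]
  have hsol : ∀ c, ∀ᶠ t in 𝓝 (0 : ℝ), G c (W c t, t) = G c (W c 0, 0) := fun c => by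
    filter_upwards [hgoodev] with t ht
    rw [hGV c t ht, hGV c 0 hgood0]
  have hW0 : ∀ c, W c 0 = ((axialAvg U₀ c : Matrix.specialUnitaryGroup (Fin 2) ℂ) : Matrix (Fin 2) (Fin 2) ℂ) := fun c => by
    rw [hWdef]
    simp only [hΓ₀0, hγ0]
    rw [axialAvg_eq_pre_mul_mul_post, Submonoid.coe_mul, Submonoid.coe_mul]
  have hprediff : ∀ c, DifferentiableAt ℝ (fun t : ℝ => ((pre (Γ₀ t) c : Matrix.specialUnitaryGroup (Fin 2) ℂ) : Matrix (Fin 2) (Fin 2) ℂ)) 0 := fun c => by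
    unfold BlockAveragingHaarAC.pre; exact differentiableAt_coe_holAt hΓ₀diff _
  have hpostdiff : ∀ c, DifferentiableAt ℝ (fun t : ℝ => ((post (Γ₀ t) c : Matrix.specialUnitaryGroup (Fin 2) ℂ) : Matrix (Fin 2) (Fin 2) ℂ)) 0 := fun c => by
    unfold BlockAveragingHaarAC.post; exact differentiableAt_coe_holAt hΓ₀diff _
  have hopendiff : ∀ c i, DifferentiableAt ℝ (fun t : ℝ => ((openHol (Γ₀ t) c i : Matrix.specialUnitaryGroup (Fin 2) ℂ) : Matrix (Fin 2) (Fin 2) ℂ)) 0 := fun c i => by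
    unfold BlockAveragingHaarAC.openHol; exact differentiableAt_coe_holAt hΓ₀diff _
  have hLip : ∀ c, ∃ C : ℝ, ∀ᶠ t in 𝓝 (0 : ℝ), ‖W c t - W c 0‖ ≤ C * |t| := by
    intro c
    obtain ⟨C₁, -, h₁⟩ := eventually_norm_sub_le_mul_of_differentiableAt (hprediff c)
    obtain ⟨C₂, -, h₂⟩ := eventually_norm_sub_le_mul_of_differentiableAt (hpostdiff c)
    refine ⟨C₁ + 2 * Cη / κ + C₂, ?_⟩
    filter_upwards [h₁, h₂, hgoodev, hηbound] with t ht₁ ht₂ ht hηt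
    have hmid : ‖((γ t (centralBond c) : Matrix.specialUnitaryGroup (Fin 2) ℂ) : Matrix (Fin 2) (Fin 2) ℂ) - ((γ 0 (centralBond c) : Matrix.specialUnitaryGroup (Fin 2) ℂ) : Matrix (Fin 2) (Fin 2) ℂ)‖
        ≤ 2 * Cη / κ * |t| := by
      have h1 := (hγspec t ht).2.2 (centralBond c)
      rw [hΓ₀ne t _ (hb₀ c)] at h1
      rw [hγ0]
      calc _ ≤ 2 * η t / κ := h1
        _ ≤ 2 * (Cη * |t|) / κ := by gcongr
        _ = 2 * Cη / κ * |t| := by ring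
    rw [hWdef]
    calc _ ≤ ‖((pre (Γ₀ t) c : Matrix.specialUnitaryGroup (Fin 2) ℂ) : Matrix (Fin 2) (Fin 2) ℂ) - ((pre (Γ₀ 0) c : Matrix.specialUnitaryGroup (Fin 2) ℂ) : Matrix (Fin 2) (Fin 2) ℂ)‖
          + ‖((γ t (centralBond c) : Matrix.specialUnitaryGroup (Fin 2) ℂ) : Matrix (Fin 2) (Fin 2) ℂ) - ((γ 0 (centralBond c) : Matrix.specialUnitaryGroup (Fin 2) ℂ) : Matrix (Fin 2) (Fin 2) ℂ)‖
          + ‖((post (Γ₀ t) c : Matrix.specialUnitaryGroup (Fin 2) ℂ) : Matrix (Fin 2) (Fin 2) ℂ) - ((post (Γ₀ 0) c : Matrix.specialUnitaryGroup (Fin 2) ℂ) : Matrix (Fin 2) (Fin 2) ℂ)‖ :=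
          norm_mul_mul_sub_le (norm_coe_su2 _).le (norm_coe_su2 _).le (norm_coe_su2 _).le (norm_coe_su2 _).le
      _ ≤ C₁ * |t| + 2 * Cη / κ * |t| + C₂ * |t| := add_le_add (add_le_add ht₁ hmid) ht₂
      _ = (C₁ + 2 * Cη / κ + C₂) * |t| := by ring
  have hv24 : stokesConst P * t₀ ≤ 1 / 24 := by nlinarith
  have hθ : ∀ c : PBond P (j + 1), (((Finset.univ.filter fun i => ¬ IsCentral c i).card : ℝ)) / (Fintype.card (Idx P) : ℝ) ≤ 1 - κ :=
    fun c => offCentral_ratio_le c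
  have hWdiff : ∀ c, DifferentiableAt ℝ (W c) 0 := by
    intro c
    have hW0u : W c 0 ∈ Matrix.unitaryGroup (Fin 2) ℂ := by rw [hW0 c]; exact (axialAvg U₀ c).2.1
    have hhu : ∀ i, ¬ IsCentral c i →
        ((openHol (Γ₀ 0) c i : Matrix.specialUnitaryGroup (Fin 2) ℂ) : Matrix (Fin 2) (Fin 2) ℂ) ∈ Matrix.unitaryGroup (Fin 2) ℂ :=
      fun i _ => (openHol (Γ₀ 0) c i).2.1
    have hTi : ∀ i, ‖(if IsCentral c i then (1 : Matrix (Fin 2) (Fin 2) ℂ) else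
        ((openHol (Γ₀ 0) c i : Matrix.specialUnitaryGroup (Fin 2) ℂ) : Matrix (Fin 2) (Fin 2) ℂ) * star (W c 0)) - 1‖ ≤ stokesConst P * t₀ := by
      intro i
      split_ifs with hc
      · rw [sub_self, norm_zero]; positivity
      · rw [hW0 c, hΓ₀0]; exact norm_openHol_mul_star_sub_one_le ht₀.le hU₀ c i
    have hTsup : ‖(fun i => if IsCentral c i then (1 : Matrix (Fin 2) (Fin 2) ℂ) else
        ((openHol (Γ₀ 0) c i : Matrix.specialUnitaryGroup (Fin 2) ℂ) : Matrix (Fin 2) (Fin 2) ℂ) * star (W c 0)) - 1‖ ≤ stokesConst P * t₀ := by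
      refine (pi_norm_le_iff_of_nonneg (by positivity)).mpr fun i => ?_
      rw [Pi.sub_apply, Pi.one_apply]; exact hTi i
    have hT13 : ‖(fun i => if IsCentral c i then (1 : Matrix (Fin 2) (Fin 2) ℂ) else
        ((openHol (Γ₀ 0) c i : Matrix.specialUnitaryGroup (Fin 2) ℂ) : Matrix (Fin 2) (Fin 2) ℂ) * star (W c 0)) - 1‖ < 1 / 3 :=
      hTsup.trans_lt (by linarith)
    have hT1 : ∀ i, ‖(if IsCentral c i then (1 : Matrix (Fin 2) (Fin 2) ℂ) else
        ((openHol (Γ₀ 0) c i : Matrix.specialUnitaryGroup (Fin 2) ℂ) : Matrix (Fin 2) (Fin 2) ℂ) * star (W c 0)) - 1‖ < 1 :=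
      fun i => (hTi i).trans_lt (by linarith)
    -- differentiability of the fibre map and its partial derivative in the coordinate
    have hGd : DifferentiableAt ℝ (G c) (W c 0, 0) := by
      rw [hGdef]
      exact differentiableAt_fibreCore_param (IsCentral c)
        (fun t i => ((openHol (Γ₀ t) c i : Matrix.specialUnitaryGroup (Fin 2) ℂ) : Matrix (Fin 2) (Fin 2) ℂ)) (W c 0) (hopendiff c) hT1
    have hA := hGd.hasFDerivAt
    have hinl : ∀ X, fderiv ℝ (G c) (W c 0, 0) (X, 0)
        = fderiv ℂ (eml : (Idx P → Matrix (Fin 2) (Fin 2) ℂ) → Matrix (Fin 2) (Fin 2) ℂ)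
            (fun i => if IsCentral c i then (1 : Matrix (Fin 2) (Fin 2) ℂ) else
              ((openHol (Γ₀ 0) c i : Matrix.specialUnitaryGroup (Fin 2) ℂ) : Matrix (Fin 2) (Fin 2) ℂ) * star (W c 0))
            (fun i => if IsCentral c i then (0 : Matrix (Fin 2) (Fin 2) ℂ) else
              ((openHol (Γ₀ 0) c i : Matrix.specialUnitaryGroup (Fin 2) ℂ) : Matrix (Fin 2) (Fin 2) ℂ) * star X) * W c 0
          + eml (fun i => if IsCentral c i then (1 : Matrix (Fin 2) (Fin 2) ℂ) else
              ((openHol (Γ₀ 0) c i : Matrix.specialUnitaryGroup (Fin 2) ℂ) : Matrix (Fin 2) (Fin 2) ℂ) * star (W c 0)) * X := by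
      intro X
      rw [hGdef]
      exact fderiv_fibreCore_param_inl (IsCentral c)
        (fun t i => ((openHol (Γ₀ t) c i : Matrix.specialUnitaryGroup (Fin 2) ℂ) : Matrix (Fin 2) (Fin 2) ℂ)) (W c 0) (hopendiff c) hT13 X
    -- the partial derivative in the coordinate as a linear map, and its lower bound `κ/2·‖X‖ ≤ ‖A(X, 0)‖`
    obtain ⟨A₁, hA₁apply⟩ : ∃ A₁ : Matrix (Fin 2) (Fin 2) ℂ →L[ℝ] Matrix (Fin 2) (Fin 2) ℂ,
        ∀ X, A₁ X = fderiv ℝ (G c) (W c 0, 0) (X, 0) := by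
      generalize fderiv ℝ (G c) (W c 0, 0) = A
      refine ⟨LinearMap.toContinuousLinearMap
        { toFun := fun X => A (X, 0)
          map_add' := fun X Y => by rw [← map_add, Prod.mk_add_mk, add_zero]
          map_smul' := fun r X => by rw [RingHom.id_apply, ← ContinuousLinearMap.map_smul, Prod.smul_mk, smul_zero] }, fun X => ?_⟩
      rw [LinearMap.coe_toContinuousLinearMap']
      rfl
    have hbound : ∀ X : Matrix (Fin 2) (Fin 2) ℂ, κ / 2 * ‖X‖ ≤ ‖A₁ X‖ := by
      intro X
      rw [hA₁apply, hinl X]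
      have hest := norm_fibreCoreDeriv_sub_le (IsCentral c)
        (fun i => ((openHol (Γ₀ 0) c i : Matrix.specialUnitaryGroup (Fin 2) ℂ) : Matrix (Fin 2) (Fin 2) ℂ)) hhu hW0u X hTsup hv24
      have hθ0 : (0 : ℝ) ≤ (((Finset.univ.filter fun i => ¬ IsCentral c i).card : ℝ)) / (Fintype.card (Idx P) : ℝ) :=
        div_nonneg (Nat.cast_nonneg _) (Nat.cast_nonneg _)
      have hcast : ((((Finset.univ.filter fun i => ¬ IsCentral c i).card : ℝ)) : ℂ) / ((Fintype.card (Idx P) : ℝ) : ℂ)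
          = (((((Finset.univ.filter fun i => ¬ IsCentral c i).card : ℝ)) / (Fintype.card (Idx P) : ℝ) : ℝ) : ℂ) := by
        rw [Complex.ofReal_div]
      rw [hcast] at hest
      exact half_mul_norm_le_of_near hest (norm_smul_conj_star_eq hW0u X hθ0) (hθ c) hsmall
    obtain ⟨B, hB⟩ := exists_leftInverse_of_bound _ (half_pos hκ) hbound
    have hB' : ∀ X : Matrix (Fin 2) (Fin 2) ℂ, B (fderiv ℝ (G c) (W c 0, 0) (X, 0)) = X := fun X => by
      have := hB X
      rwa [hA₁apply] at this
    obtain ⟨C, hC⟩ := hLip c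
    exact (hasDerivAt_of_implicit_of_lipschitz hA hB' rfl (hsol c) hC).differentiableAt
  have hcentral : ∀ c t, ((γ t (centralBond c) : Matrix.specialUnitaryGroup (Fin 2) ℂ) : Matrix (Fin 2) (Fin 2) ℂ)
      = star ((pre (Γ₀ t) c : Matrix.specialUnitaryGroup (Fin 2) ℂ) : Matrix (Fin 2) (Fin 2) ℂ) * W c t
        * star ((post (Γ₀ t) c : Matrix.specialUnitaryGroup (Fin 2) ℂ) : Matrix (Fin 2) (Fin 2) ℂ) := fun c t => by
    rw [hWdef]; exact (star_coe_mul_mul_mul_star _ _ _).symm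
  have hγdiff : ∀ b : PBond P j, DifferentiableAt ℝ (fun t : ℝ => ((γ t b : Matrix.specialUnitaryGroup (Fin 2) ℂ) : Matrix (Fin 2) (Fin 2) ℂ)) 0 := by
    intro b
    by_cases hb : ∃ c, centralBond c = b
    · obtain ⟨c, rfl⟩ := hb
      have hfun : (fun t : ℝ => ((γ t (centralBond c) : Matrix.specialUnitaryGroup (Fin 2) ℂ) : Matrix (Fin 2) (Fin 2) ℂ))
          = fun t => star ((pre (Γ₀ t) c : Matrix.specialUnitaryGroup (Fin 2) ℂ) : Matrix (Fin 2) (Fin 2) ℂ) * W c t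
            * star ((post (Γ₀ t) c : Matrix.specialUnitaryGroup (Fin 2) ℂ) : Matrix (Fin 2) (Fin 2) ℂ) := funext (hcentral c)
      rw [hfun]
      exact ((hprediff c).star.mul (hWdiff c)).mul (hpostdiff c).star
    · push Not at hb
      refine (hΓ₀diff b).congr_of_eventuallyEq ?_
      filter_upwards [hgoodev] with t ht
      rw [(hγspec t ht).2.1 b (fun c hc => hb c hc)]
  set ξ : PBond P j → Matrix (Fin 2) (Fin 2) ℂ := fun b =>
    deriv (fun t : ℝ => ((γ t b : Matrix.specialUnitaryGroup (Fin 2) ℂ) : Matrix (Fin 2) (Fin 2) ℂ) * star (U₀ b : Matrix (Fin 2) (Fin 2) ℂ)) 0 with hξ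
  have hξd : ∀ b, HasDerivAt (fun t : ℝ => ((γ t b : Matrix.specialUnitaryGroup (Fin 2) ℂ) : Matrix (Fin 2) (Fin 2) ℂ) * star (U₀ b : Matrix (Fin 2) (Fin 2) ℂ)) (ξ b) 0 :=
    fun b => ((hγdiff b).mul_const _).hasDerivAt
  have hγS : ∀ᶠ t in 𝓝 (0 : ℝ), γ t ∈ S := by
    obtain ⟨δ, hδpos, hSδ⟩ := hS
    have h1 : ∀ᶠ t in 𝓝 (0 : ℝ), ε t < δ / 2 := by
      have := (Metric.tendsto_nhds.mp hεcont) (δ / 2) (by positivity)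
      filter_upwards [this] with t ht
      rw [Real.dist_eq, sub_zero, abs_of_nonneg (hε0 t)] at ht
      exact ht
    have h2 : ∀ᶠ t in 𝓝 (0 : ℝ), η t < δ * κ / 4 := by
      have := (Metric.tendsto_nhds.mp hηcont) (δ * κ / 4) (by positivity)
      filter_upwards [this] with t ht
      rw [Real.dist_eq, sub_zero, abs_of_nonneg (hη0 t)] at ht
      exact ht
    filter_upwards [hgoodev, h1, h2] with t ht h1t h2t
    refine hSδ (γ t) (by rw [(hγspec t ht).1, hV]) fun b => ?_
    have h3 := (hγspec t ht).2.2 b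
    have h4 := hΓ₀dist t b
    have h5 : 2 * η t / κ < δ / 2 := by rw [div_lt_iff₀ hκ]; linarith
    calc _ ≤ ‖((γ t b : Matrix.specialUnitaryGroup (Fin 2) ℂ) : Matrix (Fin 2) (Fin 2) ℂ) - (Γ₀ t b : Matrix (Fin 2) (Fin 2) ℂ)‖
          + ‖((Γ₀ t b : Matrix.specialUnitaryGroup (Fin 2) ℂ) : Matrix (Fin 2) (Fin 2) ℂ) - (U₀ b : Matrix (Fin 2) (Fin 2) ℂ)‖ := norm_sub_le_norm_sub_add_norm_sub _ _ _
      _ < δ := by linarith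
  have main := lin_eq_zero_of_isMinOn_of_hasDerivAt hmin γ hγS hγ0 ξ hξd
  refine ⟨ξ, ?_, ?_, main⟩
  · -- the velocity at `b₀`
    have h1 : HasDerivAt (fun t : ℝ => ((γ t b₀ : Matrix.specialUnitaryGroup (Fin 2) ℂ) : Matrix (Fin 2) (Fin 2) ℂ) * star (U₀ b₀ : Matrix (Fin 2) (Fin 2) ℂ))
        (D₀ * star (U₀ b₀ : Matrix (Fin 2) (Fin 2) ℂ)) 0 := by
      refine (hg.mul_const (star (U₀ b₀ : Matrix (Fin 2) (Fin 2) ℂ))).congr_of_eventuallyEq ?_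
      filter_upwards [hgoodev] with t ht
      rw [(hγspec t ht).2.1 b₀ hb₀, hΓ₀b₀]
    exact (hξd b₀).unique h1
  · -- the velocity vanishes at the untouched non-central bonds
    intro b hb hbc
    have h1 : HasDerivAt (fun t : ℝ => ((γ t b : Matrix.specialUnitaryGroup (Fin 2) ℂ) : Matrix (Fin 2) (Fin 2) ℂ) * star (U₀ b : Matrix (Fin 2) (Fin 2) ℂ))
        0 0 := by
      refine (hasDerivAt_const (0 : ℝ) (((U₀ b : Matrix.specialUnitaryGroup (Fin 2) ℂ) : Matrix (Fin 2) (Fin 2) ℂ) * star (U₀ b : Matrix (Fin 2) (Fin 2) ℂ))).congr_of_eventuallyEq ?_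
      filter_upwards [hgoodev] with t ht
      rw [(hγspec t ht).2.1 b hbc, hΓ₀ne t b hb]
    exact (hξd b).unique h1

end Tangent

end Summit.QuantumFields.YangMills.Theorems.Prop8Criticality

end
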